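/-
Copyright (c) 2026 the pub-hodgecm-mathlib formalisation cell (harness21).  Prover seat hodgecm-mathlib-K2E1-p12 (g5), Track B ∕ K2-LIT, h413 = `stmt-HodgeConjecture-24833`,
R90-TF section S8 «ContSpec-n½», sub-socket (R), letter ℓ-CT (S8 dealer R90-CS-plan (g3), S8-R152 2026-09-05T00:13:23Z): the constant-term letter `hCT` of ★ p863422 OF LETTERS at a
GENERAL level — the CT shape BY DEFINITION of `ψ`, the residue letter by ★ p862860, the profile clauses by the height invariances — leaving exactly the scalar road's currency.
-/
import Summits.HodgeConjecture.HodgeConjecture.Theorems.R90S8ResGMidBlockOperatorRoadOfLettersU3   -- ★ p863422 (this seat): `hOP_of_letters`, `res_midBlock_le_residual_of_letters'` (+ ★ p863331, ★ p862884, ★ p863227, ★ p863180)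
import Summits.HodgeConjecture.HodgeConjecture.Theorems.K2E1ChiScatteringPoleSectionLimitCMThree     -- ★ p862860 (K2E2-p12): `tendsto_sub_mul_of_factor` (the residue of a factored term)
import Literature.NumberTheory.Automorphic.UnitaryGroupTruncatedKernelClassBorelCount                 -- ★ `borelHeight_arithmeticBorel_mul` (`H(b·y) = H(y)`, `b ∈ B(F)`)
import Mathlib.Analysis.SpecialFunctions.Pow.Continuity                                             -- Mathlib `Complex.continuous_ofReal_cpow_const`
import HarnessLib

/-!
# S8 sub-socket (R), letter ℓ-CT — `R90S8ResGMidBlockCTRoadOfLettersU3`: THE CONSTANT-TERM LETTER `hCT` OF ★ p863422 FROM THE SCALAR ROAD'S CURRENCY, AT A GENERAL LEVEL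

Track B ∕ R90-TF, crux h413 = `stmt-HodgeConjecture-24833`, route of record `HCCMUnconditional`; cell `hodgecm-mathlib`, section S8 «ContSpec-n½», sub-socket (R)
`sock_S8_res_midBlock_le_residual` ((R)′ for B ED. 7).  THEOREMS ONLY (no `def`, no `instance`, no `notation`, no named-fact hypothesis, no `sorry`; default heartbeats); lane
`--supports stmt-HodgeConjecture-24833 --as helper` (count-neutral).  CLOSES NO SOCKET.  ★ p863422 made (R)′ «★ modulo {L1 `hDISC`, ℓ-ROAD `hROAD`, ℓ-CT `hCT`}»; this file pays ℓ-CT from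
the SCALAR ROAD's currency `hSCAL` (★ p863385 rows (ii): the factorisation of the continued constant term near `3∕2` through the scattering scalar `qc` and the normalised intertwined
section `φt`, at most a simple pole of `qc` at `3∕2`, and the profile data of `φt(3∕2, ·)`), at EVERY level `(K′, ω)` — so (R)′ = «★ modulo {L1, ℓ-ROAD, hSCAL}» (§3).

THE DEVICE ([MoeglinWaldspurger1995, II.1.7, IV.1.9–IV.1.11]; [Langlands1976, §7]).  `hCT` asks for `(φ₀, ψ, ρψ)` with the SHAPE `(Ec z)_B g = φ₀ g·H(g)^z + ψ_z g·H(g)^{2−z}` on the whole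
slit plane `{1<Re} ∖ Sp`, the residue `(z − 3∕2)·ψ_z g → ρψ g`, and the profile clauses of `ψt := ρψ·H^{1∕2}`.  DEFINE **`ψ_z g := ((Ec z)_B g − φ g·H(g)^z) ∕ H(g)^{2−z}`** (`φ₀ := φ`,
the section itself): since `H(g) > 0` (★ `borelHeight_pos`), `H(g)^{2−z} ≠ 0` and the shape holds BY DEFINITION at every `z` — no continuation of the constant term is needed for it.  The
scalar road's letter (c1) «`(Ec z)_B g = φ g·H^z + qc z·φt z g·H^{2−z}` for `z` near `3∕2` (punctured), all `g`» then reads `ψ_z g = qc z·φt z g` there, so ★ p862860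
`tendsto_sub_mul_of_factor` with (c2) «`(z − 3∕2)·qc z → ρ`» (at most a simple pole — the VALUE of `ρ` is irrelevant here; ★ F5 produces it) and (c3) «`φt · g` continuous at `3∕2`»
gives `(z − 3∕2)·ψ_z g → ρ·φt(3∕2) g =: ρψ g`.  The profile `ψt = ρ·φt(3∕2)·H^{1∕2}`: measurable ((c4) + ★ `continuous_borelHeight` + Mathlib `Complex.continuous_ofReal_cpow_const`), left-`B(F)`-invariant
((c5) + ★ `borelHeight_arithmeticBorel_mul`), left-`N(𝔸)`-invariant ((c6) + ★ `borelHeight_unipotent_mul`), and `‖ψt g‖ ≤ ‖ρ‖·C·H(g)^{1∕2}` ((c7) + `Complex.norm_cpow_eq_rpow_re_of_pos`).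
THE LETTER `hSCAL` (closed, ∀ over `hOP`'s frame, D1's clause names, `(f, hf)`, every Heisenberg package `(ν, 𝓕)`; conclusion `∃ qc φt, (c1) ∧ … ∧ (c7)`): owner the scalar road — (c1) =
★ p863385's `hE3 ∧ hfac` merged at the defined `ψ` (R90-CS-p03 (a-2b)∕(a-7); below `Re = 2` the χ pole ledger, K2E2-p12; M1 instance ★ p862428); (c2) = ★ F5
`exists_residue_at_threeHalves_cm_three` over its letters; (c3)(c4)(c7) = (a-7)'s profile exports; (c5)(c6) = «`φt(3∕2)` is a `(χ₁ʷ, χ₂)`-pair section» (★ `chiPair_arithmeticBorel_mul` ∕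
`chiPair_unipotentInBorel_mul` once exported as such).
* §1 **`ctPackage_of_scalarRoad`** — one generator, explicit (c1)–(c7) ⊢ `hCT`'s `∃ φ₀ ψ ρψ` package.
* §2 HEAD **`hCT_of_letters (hSCAL)`** — ★ p863422's ℓ-CT letter VERBATIM from `hSCAL`.
* §3 **`res_midBlock_le_residual_of_letters''` `(hDISC) (hROAD) (hSCAL)`** — (R)′ over {L1, ℓ-ROAD, hSCAL} (★ p863422 §3 ∘ §2).
HONEST LABEL: HC_CM is proved only modulo the 7 printed citations (2 remaining named inputs: hLiu418 = `stmt-HodgeConjecture-24832`, h413 = `stmt-HodgeConjecture-24833`) until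
rung 0 closes; REL ≠ ★ ≠ BUILT; this file asserts no named fact, is conditional by construction on `hSCAL` (+ L1, ℓ-ROAD in §3), and closes no socket; count-neutral.

## References
* [MoeglinWaldspurger1995] C. Mœglin, J.-L. Waldspurger, *Spectral Decomposition and Eisenstein Series* (1995), II.1.7, IV.1.9–IV.1.11, V.3.13.
* [Langlands1976] R. P. Langlands, *On the Functional Equations Satisfied by Eisenstein Series*, LNM 544 (1976), §7.
* [Rogawski1990] J. D. Rogawski, *Automorphic Representations of Unitary Groups in Three Variables* (1990), §2.2, §13.9 p. 229 (ii).
* [Garrett2018] P. Garrett, *Modern Analysis of Automorphic Forms by Example* (2018), §2.2.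
-/

set_option autoImplicit false
set_option linter.dupNamespace false  -- the mandated namespace `…HodgeConjecture.HodgeConjecture.R90.S8` (LEAD #1 L1) repeats the summit's segment

noncomputable section

open MeasureTheory Measure Set Filter Topology NumberField IsDedekindDomain ContRepresentation
open scoped ENNReal NNReal InnerProductSpace Topology
open Literature.NumberTheory.Automorphic Literature.NumberTheory.Automorphic.UnitaryGroup Literature.NumberTheory.GaloisRepresentations AdelicGroupData
open Literature.NumberTheory.Automorphic.Arthur2013.Leaves.TECR Literature.NumberTheory.Rogawski1990
open Summit.HodgeConjecture.HodgeConjecture.Cruxes.H413.K2E1BorelEisensteinU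
open Summit.HodgeConjecture.HodgeConjecture.Cruxes.H413.K2E1ChiSectionSpaceU3PairDefs
open Summit.HodgeConjecture.HodgeConjecture.Cruxes.H413.K2E1BLBorelSpacesU2Defs
open Summit.HodgeConjecture.HodgeConjecture.Cruxes.H413.K2E1CuspidalSpectrumUnitary (residualSubspace)
open Summit.HodgeConjecture.HodgeConjecture.Cruxes.H413.K2E1ChiScatteringPoleSectionLimitCMThree (tendsto_sub_mul_of_factor)

namespace Summit.HodgeConjecture.HodgeConjecture.R90.S8

/-! ## §1 One generator: the scalar road's currency ⊢ `hCT`'s package, with `ψ` DEFINED from the constant term -/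

section OneGenerator

variable (L : Type) [Field L] [NumberField L] [IsCMField L]
  [MeasurableSpace (quasiSplit (↥(maximalRealSubfield L)) L (IsCMField.complexConj L) 3).Adelic] [BorelSpace (quasiSplit (↥(maximalRealSubfield L)) L (IsCMField.complexConj L) 3).Adelic]

/-- **THE `hCT` PACKAGE OF ONE GENERATOR FROM THE SCALAR ROAD'S CURRENCY.**  Data: the section `φ`, the continued family `Ec`, its singular set `Sp`, a Heisenberg package `(ν, 𝓕)`; letters
(c1) the factorisation of the continued constant term near `3∕2` through `qc` and `φt`, (c2) a residue-limit `ρ` of `qc` at `3∕2`, (c3) continuity of `φt · g` at `3∕2`, (c4)–(c7) the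
profile data of `φt(3∕2, ·)`.  Conclusion: ★ p863422's `∃ φ₀ ψ ρψ` package — with `φ₀ := φ`, `ψ_z g := ((Ec z)_B g − φ g·H^z) ∕ H^{2−z}` (the SHAPE is then an identity at EVERY `z`, ★
`borelHeight_pos`), `ρψ := ρ·φt(3∕2)` (★ `tendsto_sub_mul_of_factor`), profile by ★ `borelHeight_arithmeticBorel_mul` ∕ ★ `borelHeight_unipotent_mul` ∕ `Complex.norm_cpow_eq_rpow_re_of_pos`.
[cite: MoeglinWaldspurger1995, II.1.7, IV.1.11] [cite: Langlands1976, §7] [cite: Garrett2018, §2.2] -/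
theorem ctPackage_of_scalarRoad (φ : (quasiSplit (↥(maximalRealSubfield L)) L (IsCMField.complexConj L) 3).Adelic → ℂ) (Ec : ℂ → (quasiSplit (↥(maximalRealSubfield L)) L (IsCMField.complexConj L) 3).Adelic → ℂ) (Sp : Finset ℂ)
    (ν : Measure ↥(adelicUnipotent (↥(maximalRealSubfield L)) L (IsCMField.complexConj L) 3)) (𝓕 : Set ↥(adelicUnipotent (↥(maximalRealSubfield L)) L (IsCMField.complexConj L) 3))
    (qc : ℂ → ℂ) (φt : ℂ → (quasiSplit (↥(maximalRealSubfield L)) L (IsCMField.complexConj L) 3).Adelic → ℂ)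
    (hfacCT : ∀ᶠ z in 𝓝[≠] ((3 : ℂ) / 2), ∀ g : (quasiSplit (↥(maximalRealSubfield L)) L (IsCMField.complexConj L) 3).Adelic,
      borelConstantTerm ν 𝓕 (Ec z) g = φ g * (((borelHeight g : ℝ≥0) : ℝ) : ℂ) ^ z + qc z * φt z g * (((borelHeight g : ℝ≥0) : ℝ) : ℂ) ^ (2 - z))
    {ρ : ℂ} (hρ : Tendsto (fun z : ℂ => (z - ((3 : ℂ) / 2)) * qc z) (𝓝[≠] ((3 : ℂ) / 2)) (𝓝 ρ))
    (hφt : ∀ g : (quasiSplit (↥(maximalRealSubfield L)) L (IsCMField.complexConj L) 3).Adelic, ContinuousAt (fun z => φt z g) ((3 : ℂ) / 2)) (hφtm : Measurable (φt ((3 : ℂ) / 2)))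
    (hφtB : ∀ b ∈ arithmeticBorel (↥(maximalRealSubfield L)) L (IsCMField.complexConj L) 3, ∀ x : (quasiSplit (↥(maximalRealSubfield L)) L (IsCMField.complexConj L) 3).Adelic, φt ((3 : ℂ) / 2) ((b : (quasiSplit (↥(maximalRealSubfield L)) L (IsCMField.complexConj L) 3).Adelic) * x) = φt ((3 : ℂ) / 2) x)
    (hφtN : ∀ (u : ↥(adelicUnipotent (↥(maximalRealSubfield L)) L (IsCMField.complexConj L) 3)) (g : (quasiSplit (↥(maximalRealSubfield L)) L (IsCMField.complexConj L) 3).Adelic), φt ((3 : ℂ) / 2) ((u : (quasiSplit (↥(maximalRealSubfield L)) L (IsCMField.complexConj L) 3).Adelic) * g) = φt ((3 : ℂ) / 2) g)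
    {C : ℝ} (hφtbd : ∀ g : (quasiSplit (↥(maximalRealSubfield L)) L (IsCMField.complexConj L) 3).Adelic, ‖φt ((3 : ℂ) / 2) g‖ ≤ C) :
    ∃ (φ₀ : (quasiSplit (↥(maximalRealSubfield L)) L (IsCMField.complexConj L) 3).Adelic → ℂ) (ψ : ℂ → (quasiSplit (↥(maximalRealSubfield L)) L (IsCMField.complexConj L) 3).Adelic → ℂ) (ρψ : (quasiSplit (↥(maximalRealSubfield L)) L (IsCMField.complexConj L) 3).Adelic → ℂ),
        (∀ z ∈ ({z : ℂ | 1 < z.re} \ (↑Sp : Set ℂ)), ∀ g : (quasiSplit (↥(maximalRealSubfield L)) L (IsCMField.complexConj L) 3).Adelic,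
          borelConstantTerm ν 𝓕 (Ec z) g = φ₀ g * (((borelHeight g : ℝ≥0) : ℝ) : ℂ) ^ z + ψ z g * (((borelHeight g : ℝ≥0) : ℝ) : ℂ) ^ (2 - z)) ∧
        (∀ g, Tendsto (fun z : ℂ => (z - (3 : ℂ) / 2) * ψ z g) (𝓝[≠] ((3 : ℂ) / 2)) (𝓝 (ρψ g))) ∧
        Measurable (fun g : (quasiSplit (↥(maximalRealSubfield L)) L (IsCMField.complexConj L) 3).Adelic => ρψ g * (((borelHeight g : ℝ≥0) : ℝ) : ℂ) ^ (2 - (3 : ℂ) / 2)) ∧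
        (∀ b ∈ arithmeticBorel (↥(maximalRealSubfield L)) L (IsCMField.complexConj L) 3, ∀ x : (quasiSplit (↥(maximalRealSubfield L)) L (IsCMField.complexConj L) 3).Adelic, (fun g : (quasiSplit (↥(maximalRealSubfield L)) L (IsCMField.complexConj L) 3).Adelic => ρψ g * (((borelHeight g : ℝ≥0) : ℝ) : ℂ) ^ (2 - (3 : ℂ) / 2)) ((b : (quasiSplit (↥(maximalRealSubfield L)) L (IsCMField.complexConj L) 3).Adelic) * x) = (fun g : (quasiSplit (↥(maximalRealSubfield L)) L (IsCMField.complexConj L) 3).Adelic => ρψ g * (((borelHeight g : ℝ≥0) : ℝ) : ℂ) ^ (2 - (3 : ℂ) / 2)) x) ∧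
        (∀ (u : ↥(adelicUnipotent (↥(maximalRealSubfield L)) L (IsCMField.complexConj L) 3)) (g : (quasiSplit (↥(maximalRealSubfield L)) L (IsCMField.complexConj L) 3).Adelic), (fun g : (quasiSplit (↥(maximalRealSubfield L)) L (IsCMField.complexConj L) 3).Adelic => ρψ g * (((borelHeight g : ℝ≥0) : ℝ) : ℂ) ^ (2 - (3 : ℂ) / 2)) ((u : (quasiSplit (↥(maximalRealSubfield L)) L (IsCMField.complexConj L) 3).Adelic) * g) = (fun g : (quasiSplit (↥(maximalRealSubfield L)) L (IsCMField.complexConj L) 3).Adelic => ρψ g * (((borelHeight g : ℝ≥0) : ℝ) : ℂ) ^ (2 - (3 : ℂ) / 2)) g) ∧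
        ∃ K : ℝ, ∀ g : (quasiSplit (↥(maximalRealSubfield L)) L (IsCMField.complexConj L) 3).Adelic, ‖(fun g : (quasiSplit (↥(maximalRealSubfield L)) L (IsCMField.complexConj L) 3).Adelic => ρψ g * (((borelHeight g : ℝ≥0) : ℝ) : ℂ) ^ (2 - (3 : ℂ) / 2)) g‖ ≤ K * ((borelHeight g : ℝ≥0) : ℝ) ^ (1 / 2 : ℝ) := by
  -- `H(g) > 0`, so every complex power of `H(g)` is non-zero
  have hH0 : ∀ g : (quasiSplit (↥(maximalRealSubfield L)) L (IsCMField.complexConj L) 3).Adelic, ((((borelHeight g : ℝ≥0) : ℝ) : ℂ) : ℂ) ≠ 0 := fun g =>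
    Complex.ofReal_ne_zero.2 (NNReal.coe_ne_zero.2 (borelHeight_pos g).ne')
  have hpow : ∀ (g : (quasiSplit (↥(maximalRealSubfield L)) L (IsCMField.complexConj L) 3).Adelic) (w : ℂ), (((borelHeight g : ℝ≥0) : ℝ) : ℂ) ^ w ≠ 0 := fun g w => by
    rw [Ne, Complex.cpow_eq_zero_iff, not_and_or]
    exact Or.inl (hH0 g)
  refine ⟨φ, fun z g => (borelConstantTerm ν 𝓕 (Ec z) g - φ g * (((borelHeight g : ℝ≥0) : ℝ) : ℂ) ^ z) / (((borelHeight g : ℝ≥0) : ℝ) : ℂ) ^ (2 - z), fun g => ρ * φt ((3 : ℂ) / 2) g,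
    fun z _ g => ?_, fun g => ?_, ?_, fun b hb x => ?_, fun u g => ?_, ⟨‖ρ‖ * C, fun g => ?_⟩⟩
  · -- the SHAPE, by definition of `ψ`
    rw [div_mul_cancel₀ _ (hpow g (2 - z)), add_sub_cancel]
  · -- the residue letter: `ψ_z g = qc z·φt z g` near `3∕2` by (c1), then ★ `tendsto_sub_mul_of_factor`
    refine tendsto_sub_mul_of_factor (fun z g => (borelConstantTerm ν 𝓕 (Ec z) g - φ g * (((borelHeight g : ℝ≥0) : ℝ) : ℂ) ^ z) / (((borelHeight g : ℝ≥0) : ℝ) : ℂ) ^ (2 - z)) qc φt ?_ hφt hρ g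
    filter_upwards [hfacCT] with z hz g'
    rw [hz g', add_sub_cancel_left, mul_div_cancel_right₀ _ (hpow g' (2 - z))]
  · -- measurability of `ψt = ρ·φt(3∕2)·H^{1∕2}`
    have hHc : Continuous fun g : (quasiSplit (↥(maximalRealSubfield L)) L (IsCMField.complexConj L) 3).Adelic => (((borelHeight g : ℝ≥0) : ℝ) : ℂ) ^ (2 - ((3 : ℂ) / 2)) :=
      (Complex.continuous_ofReal_cpow_const (by norm_num)).comp (NNReal.continuous_coe.comp continuous_borelHeight)
    exact (measurable_const.mul hφtm).mul hHc.measurable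
  · -- left `B(F)`-invariance
    simp only [hφtB b hb x, borelHeight_arithmeticBorel_mul hb x]
  · -- left `N(𝔸)`-invariance
    simp only [hφtN u g, borelHeight_unipotent_mul u.2 g]
  · -- the bound `‖ψt g‖ ≤ ‖ρ‖·C·H(g)^{1∕2}`
    have hHpos : 0 < ((borelHeight g : ℝ≥0) : ℝ) := (borelHeight_pos g)
    have hnorm : ‖(((borelHeight g : ℝ≥0) : ℝ) : ℂ) ^ (2 - ((3 : ℂ) / 2))‖ = ((borelHeight g : ℝ≥0) : ℝ) ^ (1 / 2 : ℝ) := by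
      rw [Complex.norm_cpow_eq_rpow_re_of_pos hHpos]
      norm_num
    rw [norm_mul, norm_mul, hnorm]
    have hC0 : 0 ≤ C := (norm_nonneg _).trans (hφtbd g)
    exact mul_le_mul_of_nonneg_right (mul_le_mul_of_nonneg_left (hφtbd g) (norm_nonneg _)) (Real.rpow_nonneg hHpos.le _)

end OneGenerator

/-! ## §2 HEAD: ★ p863422's ℓ-CT letter from the scalar road's letter `hSCAL` -/

/-- **ℓ-CT OF LETTERS — `hCT` FROM `hSCAL`.**  CONCLUSION: the ℓ-CT letter `hCT` of ★ p863422 `hOP_of_letters` ∕ `res_midBlock_le_residual_of_letters'` VERBATIM (∀ over `hOP`'s frame,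
D1's clause names, `(f, hf)`, every Heisenberg package `(ν, 𝓕)`: `∃ φ₀ ψ ρψ`, SHAPE on `{1<Re}∖Sp`, residue at `3∕2`, profile clauses of `ψt`).  HYPOTHESIS: the scalar road's letter
`hSCAL` in the same frame — `∃ qc φt`, (c1) factorisation of the continued constant term near `3∕2`, (c2) a residue-limit of `qc` at `3∕2`, (c3)–(c7) the profile data of `φt`.  PROOF: §1.
[cite: MoeglinWaldspurger1995, II.1.7, IV.1.11] [cite: Langlands1976, §7] -/
theorem hCT_of_letters
    (hSCAL : ∀ (L : Type) [Field L] [NumberField L] [IsCMField L]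
      [MeasurableSpace (quasiSplit (↥(maximalRealSubfield L)) L (IsCMField.complexConj L) 3).Adelic] [BorelSpace (quasiSplit (↥(maximalRealSubfield L)) L (IsCMField.complexConj L) 3).Adelic]
      (μ : Measure (quasiSplit (↥(maximalRealSubfield L)) L (IsCMField.complexConj L) 3).automorphicQuotient) [(quasiSplit (↥(maximalRealSubfield L)) L (IsCMField.complexConj L) 3).IsAutomorphicMeasure μ]
      (𝔓 : (quasiSplit (↥(maximalRealSubfield L)) L (IsCMField.complexConj L) 3).ParabolicUnipotentData) (_ : ∀ j : 𝔓.ι, 𝔓.radical j = adelicUnipotent (↥(maximalRealSubfield L)) L (IsCMField.complexConj L) 3)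
      (μω : HeckeCharacter L) (_ : μω.IsUnitary)
      (_ : ∀ x : Literature.NumberTheory.GaloisRepresentations.ideleGroup ↥(maximalRealSubfield L),
        μω (AdeleRing.ideleBaseChange (↥(maximalRealSubfield L)) L x) = quadraticHeckeCharCM L x)
      (ξ : OneDimAutRepH L) (K' : Subgroup (quasiSplit (↥(maximalRealSubfield L)) L (IsCMField.complexConj L) 3).Adelic) (ω : ↥K' →* ℂ)
      (φ : (quasiSplit (↥(maximalRealSubfield L)) L (IsCMField.complexConj L) 3).Adelic → ℂ) (_ : φ ∈ chiSectionSpacePair (ξ.bcη⁻¹ * ξ.bcψ⁻¹ * μω) ξ.ψ K' (ω : ↥K' → ℂ)) (_ : Continuous φ)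
      (Ec : ℂ → (quasiSplit (↥(maximalRealSubfield L)) L (IsCMField.complexConj L) 3).Adelic → ℂ) (Sp : Finset ℂ) (_ : ∀ s ∈ Sp, s.im = 0 ∧ 1 < s.re ∧ s.re ≤ 2)
      (_ : ∀ g, DifferentiableOn ℂ (fun z => Ec z g) ({z : ℂ | 1 < z.re} \ (↑Sp : Set ℂ)))
      (_ : ∀ z : ℂ, 2 < z.re → Ec z = eisensteinSeriesU (flatSectionU φ z))
      (Fp : (quasiSplit (↥(maximalRealSubfield L)) L (IsCMField.complexConj L) 3).Adelic → ℂ → ℂ) (_ : ∀ g, AnalyticAt ℂ (Fp g) ((3 : ℂ) / 2))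
      (_ : ∀ g, Fp g =ᶠ[𝓝[≠] ((3 : ℂ) / 2)] fun z => (z - (3 : ℂ) / 2) * Ec z g)
      (f : (quasiSplit (↥(maximalRealSubfield L)) L (IsCMField.complexConj L) 3).L2 μ) (_ : (f : (quasiSplit (↥(maximalRealSubfield L)) L (IsCMField.complexConj L) 3).automorphicQuotient → ℂ) =ᵐ[μ] fun x => Fp (Quotient.out (x : (quasiSplit (↥(maximalRealSubfield L)) L (IsCMField.complexConj L) 3).Adelic ⧸ (quasiSplit (↥(maximalRealSubfield L)) L (IsCMField.complexConj L) 3).quotientSubgroup))⁻¹ ((3 : ℂ) / 2))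
      (ν : Measure ↥(adelicUnipotent (↥(maximalRealSubfield L)) L (IsCMField.complexConj L) 3)) (_ : ν.IsHaarMeasure) (𝓕 : Set ↥(adelicUnipotent (↥(maximalRealSubfield L)) L (IsCMField.complexConj L) 3)) (_ : IsFundamentalDomain ↥(rationalUnipotent (↥(maximalRealSubfield L)) L (IsCMField.complexConj L) 3) 𝓕 ν) (_ : IsCompact (closure 𝓕)),
      ∃ (qc : ℂ → ℂ) (φt : ℂ → (quasiSplit (↥(maximalRealSubfield L)) L (IsCMField.complexConj L) 3).Adelic → ℂ),
        (∀ᶠ z in 𝓝[≠] ((3 : ℂ) / 2), ∀ g : (quasiSplit (↥(maximalRealSubfield L)) L (IsCMField.complexConj L) 3).Adelic,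
          borelConstantTerm ν 𝓕 (Ec z) g = φ g * (((borelHeight g : ℝ≥0) : ℝ) : ℂ) ^ z + qc z * φt z g * (((borelHeight g : ℝ≥0) : ℝ) : ℂ) ^ (2 - z)) ∧
        (∃ ρ : ℂ, Tendsto (fun z : ℂ => (z - ((3 : ℂ) / 2)) * qc z) (𝓝[≠] ((3 : ℂ) / 2)) (𝓝 ρ)) ∧
        (∀ g : (quasiSplit (↥(maximalRealSubfield L)) L (IsCMField.complexConj L) 3).Adelic, ContinuousAt (fun z => φt z g) ((3 : ℂ) / 2)) ∧
        Measurable (φt ((3 : ℂ) / 2)) ∧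
        (∀ b ∈ arithmeticBorel (↥(maximalRealSubfield L)) L (IsCMField.complexConj L) 3, ∀ x : (quasiSplit (↥(maximalRealSubfield L)) L (IsCMField.complexConj L) 3).Adelic, φt ((3 : ℂ) / 2) ((b : (quasiSplit (↥(maximalRealSubfield L)) L (IsCMField.complexConj L) 3).Adelic) * x) = φt ((3 : ℂ) / 2) x) ∧
        (∀ (u : ↥(adelicUnipotent (↥(maximalRealSubfield L)) L (IsCMField.complexConj L) 3)) (g : (quasiSplit (↥(maximalRealSubfield L)) L (IsCMField.complexConj L) 3).Adelic), φt ((3 : ℂ) / 2) ((u : (quasiSplit (↥(maximalRealSubfield L)) L (IsCMField.complexConj L) 3).Adelic) * g) = φt ((3 : ℂ) / 2) g) ∧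
        ∃ C : ℝ, ∀ g : (quasiSplit (↥(maximalRealSubfield L)) L (IsCMField.complexConj L) 3).Adelic, ‖φt ((3 : ℂ) / 2) g‖ ≤ C) :
    ∀ (L : Type) [Field L] [NumberField L] [IsCMField L]
      [MeasurableSpace (quasiSplit (↥(maximalRealSubfield L)) L (IsCMField.complexConj L) 3).Adelic] [BorelSpace (quasiSplit (↥(maximalRealSubfield L)) L (IsCMField.complexConj L) 3).Adelic]
      (μ : Measure (quasiSplit (↥(maximalRealSubfield L)) L (IsCMField.complexConj L) 3).automorphicQuotient) [(quasiSplit (↥(maximalRealSubfield L)) L (IsCMField.complexConj L) 3).IsAutomorphicMeasure μ]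
      (𝔓 : (quasiSplit (↥(maximalRealSubfield L)) L (IsCMField.complexConj L) 3).ParabolicUnipotentData) (_ : ∀ j : 𝔓.ι, 𝔓.radical j = adelicUnipotent (↥(maximalRealSubfield L)) L (IsCMField.complexConj L) 3)
      (μω : HeckeCharacter L) (_ : μω.IsUnitary)
      (_ : ∀ x : Literature.NumberTheory.GaloisRepresentations.ideleGroup ↥(maximalRealSubfield L),
        μω (AdeleRing.ideleBaseChange (↥(maximalRealSubfield L)) L x) = quadraticHeckeCharCM L x)
      (ξ : OneDimAutRepH L) (K' : Subgroup (quasiSplit (↥(maximalRealSubfield L)) L (IsCMField.complexConj L) 3).Adelic) (ω : ↥K' →* ℂ)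
      (φ : (quasiSplit (↥(maximalRealSubfield L)) L (IsCMField.complexConj L) 3).Adelic → ℂ) (_ : φ ∈ chiSectionSpacePair (ξ.bcη⁻¹ * ξ.bcψ⁻¹ * μω) ξ.ψ K' (ω : ↥K' → ℂ)) (_ : Continuous φ)
      (Ec : ℂ → (quasiSplit (↥(maximalRealSubfield L)) L (IsCMField.complexConj L) 3).Adelic → ℂ) (Sp : Finset ℂ) (_ : ∀ s ∈ Sp, s.im = 0 ∧ 1 < s.re ∧ s.re ≤ 2)
      (_ : ∀ g, DifferentiableOn ℂ (fun z => Ec z g) ({z : ℂ | 1 < z.re} \ (↑Sp : Set ℂ)))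
      (_ : ∀ z : ℂ, 2 < z.re → Ec z = eisensteinSeriesU (flatSectionU φ z))
      (Fp : (quasiSplit (↥(maximalRealSubfield L)) L (IsCMField.complexConj L) 3).Adelic → ℂ → ℂ) (_ : ∀ g, AnalyticAt ℂ (Fp g) ((3 : ℂ) / 2))
      (_ : ∀ g, Fp g =ᶠ[𝓝[≠] ((3 : ℂ) / 2)] fun z => (z - (3 : ℂ) / 2) * Ec z g)
      (f : (quasiSplit (↥(maximalRealSubfield L)) L (IsCMField.complexConj L) 3).L2 μ) (_ : (f : (quasiSplit (↥(maximalRealSubfield L)) L (IsCMField.complexConj L) 3).automorphicQuotient → ℂ) =ᵐ[μ] fun x => Fp (Quotient.out (x : (quasiSplit (↥(maximalRealSubfield L)) L (IsCMField.complexConj L) 3).Adelic ⧸ (quasiSplit (↥(maximalRealSubfield L)) L (IsCMField.complexConj L) 3).quotientSubgroup))⁻¹ ((3 : ℂ) / 2))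
      (ν : Measure ↥(adelicUnipotent (↥(maximalRealSubfield L)) L (IsCMField.complexConj L) 3)) (_ : ν.IsHaarMeasure) (𝓕 : Set ↥(adelicUnipotent (↥(maximalRealSubfield L)) L (IsCMField.complexConj L) 3)) (_ : IsFundamentalDomain ↥(rationalUnipotent (↥(maximalRealSubfield L)) L (IsCMField.complexConj L) 3) 𝓕 ν) (_ : IsCompact (closure 𝓕)),
      ∃ (φ₀ : (quasiSplit (↥(maximalRealSubfield L)) L (IsCMField.complexConj L) 3).Adelic → ℂ) (ψ : ℂ → (quasiSplit (↥(maximalRealSubfield L)) L (IsCMField.complexConj L) 3).Adelic → ℂ) (ρψ : (quasiSplit (↥(maximalRealSubfield L)) L (IsCMField.complexConj L) 3).Adelic → ℂ),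
        (∀ z ∈ ({z : ℂ | 1 < z.re} \ (↑Sp : Set ℂ)), ∀ g : (quasiSplit (↥(maximalRealSubfield L)) L (IsCMField.complexConj L) 3).Adelic,
          borelConstantTerm ν 𝓕 (Ec z) g = φ₀ g * (((borelHeight g : ℝ≥0) : ℝ) : ℂ) ^ z + ψ z g * (((borelHeight g : ℝ≥0) : ℝ) : ℂ) ^ (2 - z)) ∧
        (∀ g, Tendsto (fun z : ℂ => (z - (3 : ℂ) / 2) * ψ z g) (𝓝[≠] ((3 : ℂ) / 2)) (𝓝 (ρψ g))) ∧
        Measurable (fun g : (quasiSplit (↥(maximalRealSubfield L)) L (IsCMField.complexConj L) 3).Adelic => ρψ g * (((borelHeight g : ℝ≥0) : ℝ) : ℂ) ^ (2 - (3 : ℂ) / 2)) ∧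
        (∀ b ∈ arithmeticBorel (↥(maximalRealSubfield L)) L (IsCMField.complexConj L) 3, ∀ x : (quasiSplit (↥(maximalRealSubfield L)) L (IsCMField.complexConj L) 3).Adelic, (fun g : (quasiSplit (↥(maximalRealSubfield L)) L (IsCMField.complexConj L) 3).Adelic => ρψ g * (((borelHeight g : ℝ≥0) : ℝ) : ℂ) ^ (2 - (3 : ℂ) / 2)) ((b : (quasiSplit (↥(maximalRealSubfield L)) L (IsCMField.complexConj L) 3).Adelic) * x) = (fun g : (quasiSplit (↥(maximalRealSubfield L)) L (IsCMField.complexConj L) 3).Adelic => ρψ g * (((borelHeight g : ℝ≥0) : ℝ) : ℂ) ^ (2 - (3 : ℂ) / 2)) x) ∧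
        (∀ (u : ↥(adelicUnipotent (↥(maximalRealSubfield L)) L (IsCMField.complexConj L) 3)) (g : (quasiSplit (↥(maximalRealSubfield L)) L (IsCMField.complexConj L) 3).Adelic), (fun g : (quasiSplit (↥(maximalRealSubfield L)) L (IsCMField.complexConj L) 3).Adelic => ρψ g * (((borelHeight g : ℝ≥0) : ℝ) : ℂ) ^ (2 - (3 : ℂ) / 2)) ((u : (quasiSplit (↥(maximalRealSubfield L)) L (IsCMField.complexConj L) 3).Adelic) * g) = (fun g : (quasiSplit (↥(maximalRealSubfield L)) L (IsCMField.complexConj L) 3).Adelic => ρψ g * (((borelHeight g : ℝ≥0) : ℝ) : ℂ) ^ (2 - (3 : ℂ) / 2)) g) ∧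
        ∃ K : ℝ, ∀ g : (quasiSplit (↥(maximalRealSubfield L)) L (IsCMField.complexConj L) 3).Adelic, ‖(fun g : (quasiSplit (↥(maximalRealSubfield L)) L (IsCMField.complexConj L) 3).Adelic => ρψ g * (((borelHeight g : ℝ≥0) : ℝ) : ℂ) ^ (2 - (3 : ℂ) / 2)) g‖ ≤ K * ((borelHeight g : ℝ≥0) : ℝ) ^ (1 / 2 : ℝ) := by
  intro L _ _ _ _ _ μ _ 𝔓 h𝔓 μω hμu hquad ξ K' ω φ hφV hφc Ec Sp hSp hhol hEis Fp hFp hFpE f hf ν hν 𝓕 h𝓕N h𝓕c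
  obtain ⟨qc, φt, hfacCT, ⟨ρ, hρ⟩, hφt, hφtm, hφtB, hφtN, C, hφtbd⟩ :=
    hSCAL L μ 𝔓 h𝔓 μω hμu hquad ξ K' ω φ hφV hφc Ec Sp hSp hhol hEis Fp hFp hFpE f hf ν hν 𝓕 h𝓕N h𝓕c
  exact ctPackage_of_scalarRoad L φ Ec Sp ν 𝓕 qc φt hfacCT hρ hφt hφtm hφtB hφtN hφtbd

/-! ## §3 (R)′ over {L1, ℓ-ROAD, hSCAL} -/

/-- **(R)′ OVER L1 `hDISC`, ℓ-ROAD `hROAD` AND THE SCALAR ROAD's `hSCAL`** — the conclusion bytes of ★ p863331 ∕ ★ p863422 ((R) :284 + `Nonempty 𝔓.ι`): ★ p863422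
`res_midBlock_le_residual_of_letters'` with ℓ-CT supplied by §2. [cite: MoeglinWaldspurger1995, I.2.18, IV.1.11, V.3.13] [cite: Rogawski1990, §13.9 p. 229 (ii)] -/
theorem res_midBlock_le_residual_of_letters''
    (hDISC : ∀ (L : Type) [Field L] [NumberField L] [IsCMField L]
      (μ : Measure (quasiSplit (↥(maximalRealSubfield L)) L (IsCMField.complexConj L) 3).automorphicQuotient) [(quasiSplit (↥(maximalRealSubfield L)) L (IsCMField.complexConj L) 3).IsAutomorphicMeasure μ]
      (μω : HeckeCharacter L) (_ : μω.IsUnitary) (ξ : OneDimAutRepH L), ∀ (E : Submodule ℂ (resGMidBlock L μ ξ μω).toSubmodule)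
          (hE : ∀ k, ∀ x ∈ E, ((resGMidBlock L μ ξ μω).toContRep.restrict (((standardMaximalCompactGL 3 L).comap (adelicVal (↥(maximalRealSubfield L)) L (IsCMField.complexConj L) 3 ((StdForm.antidiagonal 3).over L)) : Subgroup (quasiSplit (↥(maximalRealSubfield L)) L (IsCMField.complexConj L) 3).Adelic)).subtype) k x ∈ E), FiniteDimensional ℂ E →
          (((resGMidBlock L μ ξ μω).toContRep.restrict (((standardMaximalCompactGL 3 L).comap (adelicVal (↥(maximalRealSubfield L)) L (IsCMField.complexConj L) 3 ((StdForm.antidiagonal 3).over L)) : Subgroup (quasiSplit (↥(maximalRealSubfield L)) L (IsCMField.complexConj L) 3).Adelic)).subtype).subRep E hE).IsIrreducible →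
          FiniteDimensional ℂ (Representation.homRangeSum ((resGMidBlock L μ ξ μω).toContRep.restrict (((standardMaximalCompactGL 3 L).comap (adelicVal (↥(maximalRealSubfield L)) L (IsCMField.complexConj L) 3 ((StdForm.antidiagonal 3).over L)) : Subgroup (quasiSplit (↥(maximalRealSubfield L)) L (IsCMField.complexConj L) 3).Adelic)).subtype).toRepresentation (((resGMidBlock L μ ξ μω).toContRep.restrict (((standardMaximalCompactGL 3 L).comap (adelicVal (↥(maximalRealSubfield L)) L (IsCMField.complexConj L) 3 ((StdForm.antidiagonal 3).over L)) : Subgroup (quasiSplit (↥(maximalRealSubfield L)) L (IsCMField.complexConj L) 3).Adelic)).subtype).subRep E hE)))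
    (hROAD : ∀ (L : Type) [Field L] [NumberField L] [IsCMField L]
      [MeasurableSpace (quasiSplit (↥(maximalRealSubfield L)) L (IsCMField.complexConj L) 3).Adelic] [BorelSpace (quasiSplit (↥(maximalRealSubfield L)) L (IsCMField.complexConj L) 3).Adelic]
      (μ : Measure (quasiSplit (↥(maximalRealSubfield L)) L (IsCMField.complexConj L) 3).automorphicQuotient) [(quasiSplit (↥(maximalRealSubfield L)) L (IsCMField.complexConj L) 3).IsAutomorphicMeasure μ]
      (𝔓 : (quasiSplit (↥(maximalRealSubfield L)) L (IsCMField.complexConj L) 3).ParabolicUnipotentData) (_ : ∀ j : 𝔓.ι, 𝔓.radical j = adelicUnipotent (↥(maximalRealSubfield L)) L (IsCMField.complexConj L) 3)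
      (μω : HeckeCharacter L) (_ : μω.IsUnitary)
      (_ : ∀ x : Literature.NumberTheory.GaloisRepresentations.ideleGroup ↥(maximalRealSubfield L),
        μω (AdeleRing.ideleBaseChange (↥(maximalRealSubfield L)) L x) = quadraticHeckeCharCM L x)
      (ξ : OneDimAutRepH L) (K' : Subgroup (quasiSplit (↥(maximalRealSubfield L)) L (IsCMField.complexConj L) 3).Adelic) (ω : ↥K' →* ℂ)
      (φ : (quasiSplit (↥(maximalRealSubfield L)) L (IsCMField.complexConj L) 3).Adelic → ℂ) (_ : φ ∈ chiSectionSpacePair (ξ.bcη⁻¹ * ξ.bcψ⁻¹ * μω) ξ.ψ K' (ω : ↥K' → ℂ)) (_ : Continuous φ)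
      (Ec : ℂ → (quasiSplit (↥(maximalRealSubfield L)) L (IsCMField.complexConj L) 3).Adelic → ℂ) (Sp : Finset ℂ) (_ : ∀ s ∈ Sp, s.im = 0 ∧ 1 < s.re ∧ s.re ≤ 2)
      (_ : ∀ g, DifferentiableOn ℂ (fun z => Ec z g) ({z : ℂ | 1 < z.re} \ (↑Sp : Set ℂ)))
      (_ : ∀ z : ℂ, 2 < z.re → Ec z = eisensteinSeriesU (flatSectionU φ z))
      (Fp : (quasiSplit (↥(maximalRealSubfield L)) L (IsCMField.complexConj L) 3).Adelic → ℂ → ℂ) (_ : ∀ g, AnalyticAt ℂ (Fp g) ((3 : ℂ) / 2))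
      (_ : ∀ g, Fp g =ᶠ[𝓝[≠] ((3 : ℂ) / 2)] fun z => (z - (3 : ℂ) / 2) * Ec z g)
      (f : (quasiSplit (↥(maximalRealSubfield L)) L (IsCMField.complexConj L) 3).L2 μ) (_ : (f : (quasiSplit (↥(maximalRealSubfield L)) L (IsCMField.complexConj L) 3).automorphicQuotient → ℂ) =ᵐ[μ] fun x => Fp (Quotient.out (x : (quasiSplit (↥(maximalRealSubfield L)) L (IsCMField.complexConj L) 3).Adelic ⧸ (quasiSplit (↥(maximalRealSubfield L)) L (IsCMField.complexConj L) 3).quotientSubgroup))⁻¹ ((3 : ℂ) / 2))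
      (ν : Measure ↥(adelicUnipotent (↥(maximalRealSubfield L)) L (IsCMField.complexConj L) 3)) (_ : ν.IsHaarMeasure) (𝓕 : Set ↥(adelicUnipotent (↥(maximalRealSubfield L)) L (IsCMField.complexConj L) 3)) (_ : IsFundamentalDomain ↥(rationalUnipotent (↥(maximalRealSubfield L)) L (IsCMField.complexConj L) 3) 𝓕 ν) (_ : IsCompact (closure 𝓕)),
      ∃ (T : ℝ≥0) (_ : 1 ≤ T) (D : Set ℂ) (σ₀ : ℝ) (Fam : ℂ → (quasiSplit (↥(maximalRealSubfield L)) L (IsCMField.complexConj L) 3).L2 μ),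
        IsOpen D ∧ IsPreconnected D ∧ D ⊆ ({z : ℂ | 1 < z.re} \ (↑Sp : Set ℂ)) ∧ DifferentiableOn ℂ Fam D ∧ 2 < σ₀ ∧ (∀ᶠ z in 𝓝 ((σ₀ : ℝ) : ℂ), z ∈ D) ∧ (∀ᶠ z in 𝓝[≠] ((3 : ℂ) / 2), z ∈ D) ∧
        (∀ z ∈ D, ((Fam z : (quasiSplit (↥(maximalRealSubfield L)) L (IsCMField.complexConj L) 3).L2 μ) : (quasiSplit (↥(maximalRealSubfield L)) L (IsCMField.complexConj L) 3).automorphicQuotient → ℂ) =ᵐ[μ] (quasiSplit (↥(maximalRealSubfield L)) L (IsCMField.complexConj L) 3).quotFun (truncation ν 𝓕 T (Ec z))) ∧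
        ∃ C : ℝ, ∀ᶠ z in 𝓝[≠] ((3 : ℂ) / 2), ‖(z - (3 : ℂ) / 2) • Fam z‖ ≤ C)
    (hSCAL : ∀ (L : Type) [Field L] [NumberField L] [IsCMField L]
      [MeasurableSpace (quasiSplit (↥(maximalRealSubfield L)) L (IsCMField.complexConj L) 3).Adelic] [BorelSpace (quasiSplit (↥(maximalRealSubfield L)) L (IsCMField.complexConj L) 3).Adelic]
      (μ : Measure (quasiSplit (↥(maximalRealSubfield L)) L (IsCMField.complexConj L) 3).automorphicQuotient) [(quasiSplit (↥(maximalRealSubfield L)) L (IsCMField.complexConj L) 3).IsAutomorphicMeasure μ]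
      (𝔓 : (quasiSplit (↥(maximalRealSubfield L)) L (IsCMField.complexConj L) 3).ParabolicUnipotentData) (_ : ∀ j : 𝔓.ι, 𝔓.radical j = adelicUnipotent (↥(maximalRealSubfield L)) L (IsCMField.complexConj L) 3)
      (μω : HeckeCharacter L) (_ : μω.IsUnitary)
      (_ : ∀ x : Literature.NumberTheory.GaloisRepresentations.ideleGroup ↥(maximalRealSubfield L),
        μω (AdeleRing.ideleBaseChange (↥(maximalRealSubfield L)) L x) = quadraticHeckeCharCM L x)
      (ξ : OneDimAutRepH L) (K' : Subgroup (quasiSplit (↥(maximalRealSubfield L)) L (IsCMField.complexConj L) 3).Adelic) (ω : ↥K' →* ℂ)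
      (φ : (quasiSplit (↥(maximalRealSubfield L)) L (IsCMField.complexConj L) 3).Adelic → ℂ) (_ : φ ∈ chiSectionSpacePair (ξ.bcη⁻¹ * ξ.bcψ⁻¹ * μω) ξ.ψ K' (ω : ↥K' → ℂ)) (_ : Continuous φ)
      (Ec : ℂ → (quasiSplit (↥(maximalRealSubfield L)) L (IsCMField.complexConj L) 3).Adelic → ℂ) (Sp : Finset ℂ) (_ : ∀ s ∈ Sp, s.im = 0 ∧ 1 < s.re ∧ s.re ≤ 2)
      (_ : ∀ g, DifferentiableOn ℂ (fun z => Ec z g) ({z : ℂ | 1 < z.re} \ (↑Sp : Set ℂ)))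
      (_ : ∀ z : ℂ, 2 < z.re → Ec z = eisensteinSeriesU (flatSectionU φ z))
      (Fp : (quasiSplit (↥(maximalRealSubfield L)) L (IsCMField.complexConj L) 3).Adelic → ℂ → ℂ) (_ : ∀ g, AnalyticAt ℂ (Fp g) ((3 : ℂ) / 2))
      (_ : ∀ g, Fp g =ᶠ[𝓝[≠] ((3 : ℂ) / 2)] fun z => (z - (3 : ℂ) / 2) * Ec z g)
      (f : (quasiSplit (↥(maximalRealSubfield L)) L (IsCMField.complexConj L) 3).L2 μ) (_ : (f : (quasiSplit (↥(maximalRealSubfield L)) L (IsCMField.complexConj L) 3).automorphicQuotient → ℂ) =ᵐ[μ] fun x => Fp (Quotient.out (x : (quasiSplit (↥(maximalRealSubfield L)) L (IsCMField.complexConj L) 3).Adelic ⧸ (quasiSplit (↥(maximalRealSubfield L)) L (IsCMField.complexConj L) 3).quotientSubgroup))⁻¹ ((3 : ℂ) / 2))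
      (ν : Measure ↥(adelicUnipotent (↥(maximalRealSubfield L)) L (IsCMField.complexConj L) 3)) (_ : ν.IsHaarMeasure) (𝓕 : Set ↥(adelicUnipotent (↥(maximalRealSubfield L)) L (IsCMField.complexConj L) 3)) (_ : IsFundamentalDomain ↥(rationalUnipotent (↥(maximalRealSubfield L)) L (IsCMField.complexConj L) 3) 𝓕 ν) (_ : IsCompact (closure 𝓕)),
      ∃ (qc : ℂ → ℂ) (φt : ℂ → (quasiSplit (↥(maximalRealSubfield L)) L (IsCMField.complexConj L) 3).Adelic → ℂ),
        (∀ᶠ z in 𝓝[≠] ((3 : ℂ) / 2), ∀ g : (quasiSplit (↥(maximalRealSubfield L)) L (IsCMField.complexConj L) 3).Adelic,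
          borelConstantTerm ν 𝓕 (Ec z) g = φ g * (((borelHeight g : ℝ≥0) : ℝ) : ℂ) ^ z + qc z * φt z g * (((borelHeight g : ℝ≥0) : ℝ) : ℂ) ^ (2 - z)) ∧
        (∃ ρ : ℂ, Tendsto (fun z : ℂ => (z - ((3 : ℂ) / 2)) * qc z) (𝓝[≠] ((3 : ℂ) / 2)) (𝓝 ρ)) ∧
        (∀ g : (quasiSplit (↥(maximalRealSubfield L)) L (IsCMField.complexConj L) 3).Adelic, ContinuousAt (fun z => φt z g) ((3 : ℂ) / 2)) ∧
        Measurable (φt ((3 : ℂ) / 2)) ∧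
        (∀ b ∈ arithmeticBorel (↥(maximalRealSubfield L)) L (IsCMField.complexConj L) 3, ∀ x : (quasiSplit (↥(maximalRealSubfield L)) L (IsCMField.complexConj L) 3).Adelic, φt ((3 : ℂ) / 2) ((b : (quasiSplit (↥(maximalRealSubfield L)) L (IsCMField.complexConj L) 3).Adelic) * x) = φt ((3 : ℂ) / 2) x) ∧
        (∀ (u : ↥(adelicUnipotent (↥(maximalRealSubfield L)) L (IsCMField.complexConj L) 3)) (g : (quasiSplit (↥(maximalRealSubfield L)) L (IsCMField.complexConj L) 3).Adelic), φt ((3 : ℂ) / 2) ((u : (quasiSplit (↥(maximalRealSubfield L)) L (IsCMField.complexConj L) 3).Adelic) * g) = φt ((3 : ℂ) / 2) g) ∧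
        ∃ C : ℝ, ∀ g : (quasiSplit (↥(maximalRealSubfield L)) L (IsCMField.complexConj L) 3).Adelic, ‖φt ((3 : ℂ) / 2) g‖ ≤ C) :
    ∀ (L : Type) [Field L] [NumberField L] [IsCMField L]
      (μ : Measure (quasiSplit (↥(maximalRealSubfield L)) L (IsCMField.complexConj L) 3).automorphicQuotient) [(quasiSplit (↥(maximalRealSubfield L)) L (IsCMField.complexConj L) 3).IsAutomorphicMeasure μ]
      (𝔓 : (quasiSplit (↥(maximalRealSubfield L)) L (IsCMField.complexConj L) 3).ParabolicUnipotentData) (_ : ∀ j : 𝔓.ι, 𝔓.radical j = adelicUnipotent (↥(maximalRealSubfield L)) L (IsCMField.complexConj L) 3) (_ : Nonempty 𝔓.ι)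
      (μω : HeckeCharacter L) (_ : μω.IsUnitary),
      (∀ x : Literature.NumberTheory.GaloisRepresentations.ideleGroup ↥(maximalRealSubfield L),
        μω (AdeleRing.ideleBaseChange (↥(maximalRealSubfield L)) L x) = quadraticHeckeCharCM L x) →
      ∀ (ξ : OneDimAutRepH L), resGMidBlock L μ ξ μω ≤ residualSubspace (quasiSplit (↥(maximalRealSubfield L)) L (IsCMField.complexConj L) 3) μ 𝔓 :=
  res_midBlock_le_residual_of_letters' hDISC hROAD (hCT_of_letters hSCAL)

end Summit.HodgeConjecture.HodgeConjecture.R90.S8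

end
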